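import Summits.NavierStokesRegularity.FunctionalMining.ConvexWeightGradient
import Summits.NavierStokesRegularity.FunctionalMining.TopEigProductionTLD
import HarnessLib

/-!
# FunctionalMining — the `T_LD` differential inequality for the regularised `λ₁`-moment, viscous term kept

Search for candidate a priori estimates; no regularity claim. Cell `pub-nsfunc`, prove seat
(gen 17). The ε-level inequality behind Theorem G (ii) of SIEVELD §3.4 (`TopEigTLDOfCoercive`,
nogo N14): for an ADMISSIBLE density `g : ℝ^{3×3} → ℝ` (convex, `1`-Lipschitz, on the strains of
smooth divergence-free fields non-negative and coercive `|S| ≤ 6g(S)`; e.g. `g = λ₁`, `g = −λ₃`),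
the regularised weight `W_φ = g̃_φ^q` (`TopEigWeight`), a real `q ≥ 2` and a parameter `β > 0`:
along a classical solution of unforced Navier–Stokes (`ν > 0`) on `T³ × [a, b]`,
`F_φ(s) = ∫ W_φ(S(u s))` has at every `τ` a one-sided derivative `D` with

`D ≤ ν(1−β) · V_φ(τ) + 2βν · F_φ(τ) + q C^{1/(1−a)} (2βν/q)^{−γ} · Z_φ(τ) F_φ(τ)^{1+1/σ}`,

where `V_φ(τ) = ∫ DW_φ(S)[ΔS] ≤ 0` is the VISCOUS TERM (kept: it is what Lemma L-λ controls, via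
`TopEigHeatLine`), `Z_φ = ∫ g̃_φ(S)²`, `σ = 2q−3`, `γ = (3q−3)/(2q−3)`, `a = γ/(1+γ)`, and `C` is
assembled from a Sobolev constant, the strain and pressure-Hessian Calderón–Zygmund constants and
the coercivity factor `6` (`TopEig.weight_hasDerivWithinAt_TLD`).

Ingredients: the gen-16 balance `Ḟ_φ = νV_φ − ∫DW_φ(S)[Π] − ∫DW_φ(S)[N]` (transport integrates to
zero; `C1Weight.hasDerivWithinAt_integral_comp_fderiv`, `StrainTensor.timeDerivWithin_strainFlat_eq`);
the CONVEXITY GAIN `V_φ ≤ −2∫|∇(g̃_φ^{q/2}∘S)|²` (`ConvexWeight.integral_fderiv_sq_laplacian_le`,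
`W_φ = (g̃_φ^{q/2})²`, `g̃_φ^{q/2}` convex for `q ≥ 2`); the Lebesgue chain `TopEig.lebesgue_chain` for
both productions; Young at the weights `(a, 1−a)` with the small parameter `2βν/q`, half of whose
`J = X + F` is paid by the convexity gain and the other half (`2βνF`) is left for Lemma L-λ. [ours]
-/

noncomputable section

open MeasureTheory Set Filter Topology Finset
open scoped InnerProductSpace RealInnerProductSpace ContDiff

namespace Summit.NavierStokesRegularity.FunctionalMining

open Literature.Analysis.FunctionSpaces Literature.Analysis.FluidPDE

namespace TopEig

open StrainL4 StrainMoment VorticityL4 StrainTensor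

/-- **The `T_LD` differential inequality for `F_φ = ∫ W_φ(S)`, viscous term kept** (module
docstring). [ours] -/
theorem weight_hasDerivWithinAt_TLD {q : ℝ} (hq : 2 ≤ q) {CS K CP : ℝ} (hCS : 0 ≤ CS) (hK0 : 0 ≤ K)
    (hCP0 : 0 ≤ CP)
    (hSob : ∀ w : UnitAddTorus (Fin 3) → ℝ, Torus.IsSmooth w →
      ∫ x, ‖w x‖ ^ 6 ≤ CS * ((∫ x, ‖w x‖ ^ 2) + ∫ x, ∑ k, ‖Torus.partialDeriv k w x‖ ^ 2) ^ 3)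
    (hK : ∀ v : UnitAddTorus (Fin 3) → EuclideanSpace ℝ (Fin 3), Torus.IsSmooth v →
      Torus.IsDivFree v →
      ∫ x, (∑ k, ‖Torus.partialDeriv k v x‖ ^ 2) ^ q ≤ K * ∫ x, ‖strainFlat v x‖ ^ (2 * q))
    {a b ν : ℝ} (hab : a < b) (hν : 0 < ν)
    {u : ℝ → UnitAddTorus (Fin 3) → EuclideanSpace ℝ (Fin 3)} {p : ℝ → UnitAddTorus (Fin 3) → ℝ}
    (hsol : Torus.IsClassicalNSSolutionOn (Icc a b) ν 0 u p)
    (hCP : ∀ t ∈ Icc a b, ∀ i j : Fin 3,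
      ∫ x, |Torus.partialDeriv i (Torus.partialDeriv j (p t)) x| ^ q ≤
        CP * ∫ x, (∑ k, ‖Torus.partialDeriv k (u t) x‖ ^ 2) ^ q)
    {g : EuclideanSpace ℝ (Fin 3 × Fin 3) → ℝ} (hconv : ConvexOn ℝ univ g) (hlip : LipschitzWith 1 g)
    (hg0 : ∀ v : UnitAddTorus (Fin 3) → EuclideanSpace ℝ (Fin 3), Torus.IsSmooth v →
      Torus.IsDivFree v → ∀ x, 0 ≤ g (strainFlat v x))
    (hg6 : ∀ v : UnitAddTorus (Fin 3) → EuclideanSpace ℝ (Fin 3), Torus.IsSmooth v →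
      Torus.IsDivFree v → ∀ x, ‖strainFlat v x‖ ≤ 6 * g (strainFlat v x))
    (φ : ContDiffBump (0 : EuclideanSpace ℝ (Fin 3 × Fin 3))) {τ : ℝ} (hτ : τ ∈ Icc a b)
    {β : ℝ} (hβ0 : 0 < β) :
    ∃ D : ℝ, HasDerivWithinAt (fun s => ∫ y, weight φ g q (strainFlat (u s) y)) D (Icc a b) τ ∧
      D ≤ ν * (1 - β) *
            (∫ y, fderiv ℝ (weight φ g q) (strainFlat (u τ) y) (Torus.laplacian (strainFlat (u τ)) y)) +
          2 * β * ν * (∫ y, weight φ g q (strainFlat (u τ) y)) +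
          q * (Real.sqrt 2 * (1 * K * (6 : ℝ) ^ (2 * q)) ^ (1 / q) * CS ^ ((3 * q - 3) / (5 * q - 6) / 3) +
                Real.sqrt 2 * ((9 : ℝ) ^ q * CP * K * (6 : ℝ) ^ (2 * q)) ^ (1 / q) *
                  CS ^ ((3 * q - 3) / (5 * q - 6) / 3)) ^ (1 / (1 - (3 * q - 3) / (5 * q - 6))) *
              (2 * β * ν / q) ^ (-((3 * q - 3) / (2 * q - 3))) *
            ((∫ y, lamReg φ g (strainFlat (u τ) y) ^ (2 : ℝ)) *
              (∫ y, weight φ g q (strainFlat (u τ) y)) ^ (1 + (2 * q - 3)⁻¹)) := by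
  have hq0 : 0 < q := by linarith
  have hq1 : 1 < q := by linarith
  have hq1' : (1 : ℝ) ≤ q := hq1.le
  have hq2 : (1 : ℝ) ≤ q / 2 := by linarith
  have hU : UniqueDiffOn ℝ (Icc a b) := uniqueDiffOn_Icc hab
  have hu : Torus.IsSmoothSpaceTimeOn (Icc a b) u := hsol.smooth_velocity
  have hut : Torus.IsSmooth (u τ) := hu.isSmooth_slice hτ
  have hu1 : Torus.IsContDiff 1 (u τ) := hut.isContDiff (by simp)
  have hdiv : Torus.IsDivFree (u τ) := hsol.divFree τ hτ
  have hpt : Torus.IsSmooth (p τ) := hsol.smooth_pressure.isSmooth_slice hτ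
  -- the packaged strain, the open set and the weights
  set Θ : ℝ → UnitAddTorus (Fin 3) → EuclideanSpace ℝ (Fin 3 × Fin 3) :=
    fun s y => strainFlat (u s) y with hΘdef
  have hΘ : Torus.IsSmoothSpaceTimeOn (Icc a b) Θ := isSmoothSpaceTimeOn_strainFlat hu hU
  have hΘt : Torus.IsSmooth (Θ τ) := isSmooth_strainFlat hut
  have hΘt1 : Torus.IsContDiff 1 (Θ τ) := hΘt.isContDiff (by simp)
  have hgc : Continuous g := hlip.continuous
  have hUo : IsOpen (posSet φ g) := isOpen_posSet φ hgc
  have hmaps : ∀ s ∈ Icc a b, ∀ y, Θ s y ∈ posSet φ g := fun s hs y =>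
    (mem_posSet_of_nonneg φ hlip (hg0 _ (hu.isSmooth_slice hs) (hsol.divFree s hs) y)).1
  have hmapsτ : ∀ y, Θ τ y ∈ posSet φ g := hmaps τ hτ
  set W : EuclideanSpace ℝ (Fin 3 × Fin 3) → ℝ := weight φ g q with hWdef
  set ψ : EuclideanSpace ℝ (Fin 3 × Fin 3) → ℝ := weight φ g (q / 2) with hψdef
  have hW1 : ContDiffOn ℝ 1 W (posSet φ g) := contDiffOn_weight φ hgc q (by norm_cast)
  have hW2 : ContDiffOn ℝ 2 W (posSet φ g) := contDiffOn_weight φ hgc q (by norm_cast)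
  have hψ2 : ContDiffOn ℝ 2 ψ (posSet φ g) := contDiffOn_weight φ hgc (q / 2) (by norm_cast)
  have hWd : ∀ y, DifferentiableAt ℝ W (Θ τ y) := fun y =>
    ((hW1.differentiableOn (by simp)).differentiableAt (hUo.mem_nhds (hmapsτ y)))
  -- Step 1: differentiate under the integral sign
  have hD := C1Weight.hasDerivWithinAt_integral_comp_fderiv hab hΘ hUo hW1 hmaps hτ
  refine ⟨_, hD, ?_⟩
  -- names for the densities
  set ρ : UnitAddTorus (Fin 3) → ℝ := fun y => lamReg φ g (Θ τ y) with hρdef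
  set gd : UnitAddTorus (Fin 3) → ℝ := fun y => ∑ k, ‖Torus.partialDeriv k (u τ) y‖ ^ 2 with hgddef
  set h : UnitAddTorus (Fin 3) → ℝ := fun y =>
    ∑ i, ∑ j, |Torus.partialDeriv i (Torus.partialDeriv j (p τ)) y| with hhdef
  set w : UnitAddTorus (Fin 3) → ℝ := fun y => ψ (Θ τ y) with hwdef
  have hρpos : ∀ y, 0 < ρ y := fun y => hmapsτ y
  have hρc : Continuous ρ := (contDiff_lamReg φ hgc).continuous.comp hΘt.continuous
  have hgdc : Continuous gd := continuous_gradSq hut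
  have hhc : Continuous h := continuous_hessAbs hpt
  have hgd0 : ∀ y, 0 ≤ gd y := fun y => Finset.sum_nonneg fun k _ => sq_nonneg _
  have hh0 : ∀ y, 0 ≤ h y := fun y =>
    Finset.sum_nonneg fun i _ => Finset.sum_nonneg fun j _ => abs_nonneg _
  have hWρ : ∀ y, W (Θ τ y) = ρ y ^ q := fun y => rfl
  obtain ⟨F, hF⟩ : ∃ F : ℝ, F = ∫ y, W (Θ τ y) := ⟨_, rfl⟩
  have hF0 : 0 ≤ F := by rw [hF]; exact integral_nonneg fun y => weight_nonneg φ q (hmapsτ y)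
  have hFρ : ∫ y, ρ y ^ q = F := by rw [hF]; rfl
  obtain ⟨Z, hZ⟩ : ∃ Z : ℝ, Z = ∫ y, ρ y ^ (2 : ℝ) := ⟨_, rfl⟩
  have hZ0 : 0 ≤ Z := by rw [hZ]; exact integral_nonneg fun y => Real.rpow_nonneg (hρpos y).le _
  obtain ⟨X, hX⟩ : ∃ X : ℝ, X = ∫ y, ∑ k, (Torus.partialDeriv k w y) ^ 2 := ⟨_, rfl⟩
  have hX0 : 0 ≤ X := by rw [hX]; exact integral_nonneg fun y => Finset.sum_nonneg fun k _ => sq_nonneg _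
  -- the four pieces of `DW(S)[∂ₜS]`
  set A : UnitAddTorus (Fin 3) → ℝ := fun y =>
    fderiv ℝ W (Θ τ y) (Torus.laplacian (Θ τ) y) with hAdef
  set Pp : UnitAddTorus (Fin 3) → ℝ := fun y => fderiv ℝ W (Θ τ y) (pressVec (p τ) y) with hPdef
  set Nn : UnitAddTorus (Fin 3) → ℝ := fun y => fderiv ℝ W (Θ τ y) (nonlinVec (u τ) y) with hNdef
  set B : UnitAddTorus (Fin 3) → ℝ := fun y =>
    fderiv ℝ W (Θ τ y) (∑ k, u τ y k • Torus.partialDeriv k (Θ τ) y) with hBdef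
  have hsplit : ∀ y, fderiv ℝ W (Θ τ y) (Torus.timeDerivWithin (Icc a b) Θ τ y) =
      ν * A y - Pp y - Nn y - B y := by
    intro y
    rw [show Torus.timeDerivWithin (Icc a b) Θ τ y =
        Torus.timeDerivWithin (Icc a b) (fun s z => strainFlat (u s) z) τ y from rfl,
      timeDerivWithin_strainFlat_eq hsol hab hτ y]
    simp only [hAdef, hPdef, hNdef, hBdef, map_sub, map_smul, smul_eq_mul,
      show (0 : ℝ → UnitAddTorus (Fin 3) → EuclideanSpace ℝ (Fin 3)) τ = 0 from rfl,
      strainFlat_zero, add_zero]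
    rfl
  -- continuity of the pieces
  have hcA : Continuous A :=
    ConvexWeight.continuous_fderiv_apply hUo hW2 hΘt hmapsτ hΘt.laplacian.continuous
  have hcP : Continuous Pp :=
    ConvexWeight.continuous_fderiv_apply hUo hW2 hΘt hmapsτ (isSmooth_pressVec hpt).continuous
  have hcN : Continuous Nn :=
    ConvexWeight.continuous_fderiv_apply hUo hW2 hΘt hmapsτ (isSmooth_nonlinVec hut).continuous
  have hcB : Continuous B := by
    refine ConvexWeight.continuous_fderiv_apply hUo hW2 hΘt hmapsτ ?_
    exact continuous_finsetSum _ fun k _ =>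
      ((hut.apply k).continuous).smul (hΘt.partialDeriv k).continuous
  -- Step 2: the convexity gain `∫A ≤ -2X`
  have hA : ∫ y, A y ≤ -2 * X := by
    have hWsq : ∀ z ∈ posSet φ g, W z = ψ z ^ 2 := fun z hz => (weight_half_sq φ q hz).symm
    have h := ConvexWeight.integral_fderiv_sq_laplacian_le hUo hψ2 hWsq hΘt hmapsτ
      (fun y v => hessian_weight_nonneg φ hconv hlip hq2 (hmapsτ y) v)
      (fun y => weight_nonneg φ (q / 2) (hmapsτ y))
    rw [hX]
    exact h
  -- Step 3: the transport piece integrates to zero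
  have hB : ∫ y, B y = 0 := by
    set gW : UnitAddTorus (Fin 3) → ℝ := fun y => W (Θ τ y) with hgW
    have hgW1 : Torus.IsContDiff 1 gW := by
      unfold Torus.IsContDiff
      exact hW1.comp_contDiff hΘt1 fun x => hmapsτ _
    have hgk : ∀ k y, Torus.partialDeriv k gW y = fderiv ℝ W (Θ τ y) (Torus.partialDeriv k (Θ τ) y) :=
      fun k y => partialDeriv_comp_eq_fderiv hΘt1 y (hWd y) k
    have hpt' : ∀ y, B y = Torus.divergence (fun z => gW z • u τ z) y := by
      intro y
      rw [Torus.divergence_smul hgW1 hu1 y, hdiv y, mul_zero, zero_add, hBdef]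
      simp only [map_sum, map_smul, smul_eq_mul, hgk]
    simp_rw [hpt']
    have hgu : Torus.IsContDiff 1 (fun z => gW z • u τ z) := by
      unfold Torus.IsContDiff at hgW1 hu1 ⊢
      exact hgW1.smul hu1
    exact Torus.integral_divergence_eq_zero_of_isContDiff hgu
  -- Step 4: the productions through the Lebesgue chain
  obtain ⟨e, he⟩ : ∃ e : ℝ, e = (3 * q - 3) / (5 * q - 6) := ⟨_, rfl⟩
  obtain ⟨M, hM⟩ : ∃ M : ℝ, M = Z * F ^ (1 + (2 * q - 3)⁻¹) := ⟨_, rfl⟩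
  have hM0 : 0 ≤ M := by rw [hM]; exact mul_nonneg hZ0 (Real.rpow_nonneg hF0 _)
  obtain ⟨CN, hCN⟩ : ∃ C : ℝ,
      C = Real.sqrt 2 * (1 * K * (6 : ℝ) ^ (2 * q)) ^ (1 / q) * CS ^ (e / 3) := ⟨_, rfl⟩
  obtain ⟨CQ, hCQ⟩ : ∃ C : ℝ,
      C = Real.sqrt 2 * ((9 : ℝ) ^ q * CP * K * (6 : ℝ) ^ (2 * q)) ^ (1 / q) * CS ^ (e / 3) :=
    ⟨_, rfl⟩
  have hCN0 : 0 ≤ CN := by rw [hCN]; positivity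
  have hCQ0 : 0 ≤ CQ := by rw [hCQ]; positivity
  have h56 : 0 < 5 * q - 6 := by linarith
  have h23 : 0 < 2 * q - 3 := by linarith
  have he0 : 0 < e := by rw [he]; exact div_pos (by linarith) h56
  have he1 : e < 1 := by rw [he, div_lt_one h56]; linarith
  have h1e : 1 - e = (2 * q - 3) / (5 * q - 6) := by
    rw [he, one_sub_div h56.ne']; congr 1; ring
  have hγ : e / (1 - e) = (3 * q - 3) / (2 * q - 3) := by
    rw [h1e, he, div_div_div_cancel_right₀ h56.ne']
  -- |∫ DW[X]| ≤ q ∫ ρ^{q-1} b whenever ‖X‖ ≤ b pointwise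
  have hprod : ∀ {Xv : UnitAddTorus (Fin 3) → EuclideanSpace ℝ (Fin 3 × Fin 3)}
      {bX : UnitAddTorus (Fin 3) → ℝ}, Continuous (fun y => fderiv ℝ W (Θ τ y) (Xv y)) →
      Continuous bX → (∀ y, ‖Xv y‖ ≤ bX y) →
      |∫ y, fderiv ℝ W (Θ τ y) (Xv y)| ≤ q * ∫ y, ρ y ^ (q - 1) * bX y := by
    intro Xv bX hcX hcb hXb
    have hpt : ∀ y, |fderiv ℝ W (Θ τ y) (Xv y)| ≤ q * (ρ y ^ (q - 1) * bX y) := fun y =>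
      calc |fderiv ℝ W (Θ τ y) (Xv y)| ≤ q * lamReg φ g (Θ τ y) ^ (q - 1) * ‖Xv y‖ :=
            abs_fderiv_weight_apply_le φ hlip hq0.le (hmapsτ y) (Xv y)
        _ ≤ q * lamReg φ g (Θ τ y) ^ (q - 1) * bX y :=
            mul_le_mul_of_nonneg_left (hXb y)
              (mul_nonneg hq0.le (Real.rpow_nonneg (hρpos y).le _))
        _ = q * (ρ y ^ (q - 1) * bX y) := by ring
    have hc : Continuous fun y => q * (ρ y ^ (q - 1) * bX y) :=
      continuous_const.mul ((hρc.rpow_const fun y => Or.inl (hρpos y).ne').mul hcb)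
    calc |∫ y, fderiv ℝ W (Θ τ y) (Xv y)| ≤ ∫ y, |fderiv ℝ W (Θ τ y) (Xv y)| :=
          abs_integral_le_integral_abs
      _ ≤ ∫ y, q * (ρ y ^ (q - 1) * bX y) :=
          integral_mono_of_nonneg (ae_of_all _ fun y => abs_nonneg _) hc.integrable_unitAddTorus
            (ae_of_all _ hpt)
      _ = q * ∫ y, ρ y ^ (q - 1) * bX y := integral_const_mul _ _
  have hg0τ : ∀ y, 0 ≤ g (strainFlat (u τ) y) := fun y => hg0 _ hut hdiv y
  have hg6τ : ∀ y, ‖strainFlat (u τ) y‖ ≤ 6 * g (strainFlat (u τ) y) := fun y => hg6 _ hut hdiv y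
  have hKτ := hK (u τ) hut hdiv
  -- the chain bounds, in the form `∫ρ^{q-1} b ≤ C' (X+F)^e M^{1-e}`
  have hchainN : ∫ y, ρ y ^ (q - 1) * gd y ≤ CN * (X + F) ^ e * M ^ (1 - e) := by
    have hbq : ∫ x, gd x ^ q ≤ 1 * ∫ x, (∑ k, ‖Torus.partialDeriv k (u τ) x‖ ^ 2) ^ q := by
      rw [one_mul]
    have hc' := lebesgue_chain hq hCS hK0 zero_le_one hSob φ hlip hut hg0τ hg6τ hKτ hgdc hgd0 hbq
    rw [← hX, hFρ, ← hZ, ← he, ← hM] at hc'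
    calc ∫ y, ρ y ^ (q - 1) * gd y
        ≤ Real.sqrt 2 * (1 * K * (6 : ℝ) ^ (2 * q)) ^ (1 / q) * CS ^ (e / 3) * (X + F) ^ e *
            M ^ (1 - e) := hc'
      _ = CN * (X + F) ^ e * M ^ (1 - e) := by rw [hCN]
  have hchainP : ∫ y, ρ y ^ (q - 1) * h y ≤ CQ * (X + F) ^ e * M ^ (1 - e) := by
    have hbq : ∫ x, h x ^ q ≤ (9 : ℝ) ^ q * CP * ∫ x, (∑ k, ‖Torus.partialDeriv k (u τ) x‖ ^ 2) ^ q := by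
      have hH := integral_sum_abs_rpow_le (d := Fin 3)
        (H := fun i j x => Torus.partialDeriv i (Torus.partialDeriv j (p τ)) x)
        (fun i j => ((hpt.partialDeriv j).partialDeriv i).continuous) hq1'
      simp only [Fintype.card_fin, Nat.cast_ofNat] at hH
      have hsum : ∑ i : Fin 3, ∑ j : Fin 3,
          ∫ x, |Torus.partialDeriv i (Torus.partialDeriv j (p τ)) x| ^ q ≤
          ∑ _i : Fin 3, ∑ _j : Fin 3, CP * ∫ y, gd y ^ q :=
        Finset.sum_le_sum fun i _ => Finset.sum_le_sum fun j _ => hCP τ hτ i j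
      have hsum' : ∑ _i : Fin 3, ∑ _j : Fin 3, CP * ∫ y, gd y ^ q = 9 * (CP * ∫ y, gd y ^ q) := by
        simp only [Finset.sum_const, Finset.card_univ, Fintype.card_fin]
        ring
      have h9' : ((3 : ℝ) ^ 2) ^ (q - 1) * 9 = (9 : ℝ) ^ q := by
        rw [show (3 : ℝ) ^ 2 = 9 by norm_num, Real.rpow_sub (by norm_num : (0 : ℝ) < 9),
          Real.rpow_one]
        field_simp
      have h9q : 0 ≤ ((3 : ℝ) ^ 2) ^ (q - 1) := Real.rpow_nonneg (by norm_num) _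
      calc ∫ y, h y ^ q ≤ ((3 : ℝ) ^ 2) ^ (q - 1) *
            ∑ i : Fin 3, ∑ j : Fin 3,
              ∫ x, |Torus.partialDeriv i (Torus.partialDeriv j (p τ)) x| ^ q := hH
        _ ≤ ((3 : ℝ) ^ 2) ^ (q - 1) * (9 * (CP * ∫ y, gd y ^ q)) := by
            rw [← hsum']; exact mul_le_mul_of_nonneg_left hsum h9q
        _ = (((3 : ℝ) ^ 2) ^ (q - 1) * 9) * CP * ∫ y, gd y ^ q := by ring
        _ = (9 : ℝ) ^ q * CP * ∫ y, gd y ^ q := by rw [h9']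
    have h9CP : 0 ≤ (9 : ℝ) ^ q * CP := by positivity
    have hc' := lebesgue_chain hq hCS hK0 h9CP hSob φ hlip hut hg0τ hg6τ hKτ hhc hh0 hbq
    rw [← hX, hFρ, ← hZ, ← he, ← hM] at hc'
    calc ∫ y, ρ y ^ (q - 1) * h y
        ≤ Real.sqrt 2 * ((9 : ℝ) ^ q * CP * K * (6 : ℝ) ^ (2 * q)) ^ (1 / q) * CS ^ (e / 3) *
            (X + F) ^ e * M ^ (1 - e) := hc'
      _ = CQ * (X + F) ^ e * M ^ (1 - e) := by rw [hCQ]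
  have hNle : |∫ y, Nn y| ≤ q * (CN * (X + F) ^ e * M ^ (1 - e)) :=
    (hprod hcN hgdc (fun y => norm_nonlinVec_le (u τ) y)).trans
      (mul_le_mul_of_nonneg_left hchainN hq0.le)
  have hPle : |∫ y, Pp y| ≤ q * (CQ * (X + F) ^ e * M ^ (1 - e)) :=
    (hprod hcP hhc (fun y => norm_pressVec_le (p τ) y)).trans
      (mul_le_mul_of_nonneg_left hchainP hq0.le)
  -- Step 5: Young with the parameter `ν' = 2βν/q`
  have hν' : 0 < 2 * β * ν / q := by positivity
  have hXF : 0 ≤ X + F := add_nonneg hX0 hF0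
  have hC0 : 0 ≤ CN + CQ := add_nonneg hCN0 hCQ0
  have hY := VorticityMoment.young_rpow he0 he1 hC0 hXF hM0 hν'
  -- Step 6: assemble
  have hval : (∫ y, fderiv ℝ W (Θ τ y) (Torus.timeDerivWithin (Icc a b) Θ τ y)) =
      ν * (∫ y, A y) - (∫ y, Pp y) - (∫ y, Nn y) - ∫ y, B y := by
    simp_rw [hsplit]
    have hiA : Integrable (fun y => ν * A y) := (continuous_const.mul hcA).integrable_unitAddTorus
    have hiP := hcP.integrable_unitAddTorus
    have hiN := hcN.integrable_unitAddTorus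
    have hiB := hcB.integrable_unitAddTorus
    have hi2 : Integrable (fun y => ν * A y - Pp y) := hiA.sub hiP
    have hi3 : Integrable (fun y => ν * A y - Pp y - Nn y) := hi2.sub hiN
    rw [integral_sub hi3 hiB, integral_sub hi2 hiN, integral_sub hiA hiP, integral_const_mul]
  rw [hval, hB, sub_zero]
  -- rewrite the goal's constants
  have hFint : (∫ y, weight φ g q (strainFlat (u τ) y)) = F := by rw [hF]
  have hZint : (∫ y, lamReg φ g (strainFlat (u τ) y) ^ (2 : ℝ)) = Z := by rw [hZ]
  rw [hFint, hZint, ← he, ← hγ, ← hM]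
  have hC : Real.sqrt 2 * (1 * K * (6 : ℝ) ^ (2 * q)) ^ (1 / q) * CS ^ (e / 3) +
      Real.sqrt 2 * ((9 : ℝ) ^ q * CP * K * (6 : ℝ) ^ (2 * q)) ^ (1 / q) * CS ^ (e / 3) = CN + CQ := by
    rw [hCN, hCQ]
  rw [hC]
  -- the inequalities to combine
  have hP' : -(∫ y, Pp y) ≤ |∫ y, Pp y| := neg_le_abs _
  have hN' : -(∫ y, Nn y) ≤ |∫ y, Nn y| := neg_le_abs _
  have hstat : |∫ y, Nn y| + |∫ y, Pp y| ≤ q * ((CN + CQ) * (X + F) ^ e * M ^ (1 - e)) := by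
    have h := add_le_add hNle hPle
    have e1 : q * (CN * (X + F) ^ e * M ^ (1 - e)) + q * (CQ * (X + F) ^ e * M ^ (1 - e)) =
        q * ((CN + CQ) * (X + F) ^ e * M ^ (1 - e)) := by ring
    linarith
  have hYq : q * ((CN + CQ) * (X + F) ^ e * M ^ (1 - e)) ≤
      q * (2 * β * ν / q * (X + F) + (CN + CQ) ^ (1 / (1 - e)) * (2 * β * ν / q) ^ (-(e / (1 - e))) * M) :=
    mul_le_mul_of_nonneg_left hY hq0.le
  have hqq : q * (2 * β * ν / q) = 2 * β * ν := by field_simp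
  have hsplitq : q * (2 * β * ν / q * (X + F)) = 2 * β * ν * X + 2 * β * ν * F := by
    rw [← mul_assoc, hqq]; ring
  have hβν : 0 ≤ β * ν := by positivity
  have hgain : 2 * β * ν * X ≤ -(β * ν) * ∫ y, A y := by
    have h1 := mul_le_mul_of_nonneg_left hA hβν
    linarith
  set IA := ∫ y, A y with hIA
  set KK := (CN + CQ) ^ (1 / (1 - e)) * (2 * β * ν / q) ^ (-(e / (1 - e))) with hKK
  have hfin : ν * IA - (∫ y, Pp y) - (∫ y, Nn y) ≤
      ν * (1 - β) * IA + 2 * β * ν * F + q * KK * M := by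
    have h1 : ν * IA - (∫ y, Pp y) - (∫ y, Nn y) ≤ ν * IA + (|∫ y, Nn y| + |∫ y, Pp y|) := by
      linarith
    have h2 : |∫ y, Nn y| + |∫ y, Pp y| ≤ 2 * β * ν * X + 2 * β * ν * F + q * KK * M := by
      have h3 := hstat.trans hYq
      rw [mul_add, hsplitq] at h3
      have e2 : q * ((CN + CQ) ^ (1 / (1 - e)) * (2 * β * ν / q) ^ (-(e / (1 - e))) * M) =
          q * KK * M := by rw [hKK]; ring
      linarith
    linarith [hgain]
  calc ν * IA - (∫ y, Pp y) - (∫ y, Nn y) ≤ ν * (1 - β) * IA + 2 * β * ν * F + q * KK * M := hfin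
    _ = ν * (1 - β) * IA + 2 * β * ν * F + q * (CN + CQ) ^ (1 / (1 - e)) *
        (2 * β * ν / q) ^ (-(e / (1 - e))) * M := by rw [hKK]; ring

/-- **The same inequality with the `ν`-dependence factored**: the constant in front of
`ν^{−γ} Z_φ F_φ^{1+1/σ}` depends only on `q`, `β` and the static constants (`(2βν/q)^{−γ} =
(2β/q)^{−γ} ν^{−γ}`). [ours] -/
theorem weight_hasDerivWithinAt_TLD' {q : ℝ} (hq : 2 ≤ q) {CS K CP : ℝ} (hCS : 0 ≤ CS) (hK0 : 0 ≤ K)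
    (hCP0 : 0 ≤ CP)
    (hSob : ∀ w : UnitAddTorus (Fin 3) → ℝ, Torus.IsSmooth w →
      ∫ x, ‖w x‖ ^ 6 ≤ CS * ((∫ x, ‖w x‖ ^ 2) + ∫ x, ∑ k, ‖Torus.partialDeriv k w x‖ ^ 2) ^ 3)
    (hK : ∀ v : UnitAddTorus (Fin 3) → EuclideanSpace ℝ (Fin 3), Torus.IsSmooth v →
      Torus.IsDivFree v →
      ∫ x, (∑ k, ‖Torus.partialDeriv k v x‖ ^ 2) ^ q ≤ K * ∫ x, ‖strainFlat v x‖ ^ (2 * q))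
    {β : ℝ} (hβ0 : 0 < β) :
    ∃ Kc : ℝ, 0 ≤ Kc ∧ ∀ {a b ν : ℝ}, a < b → 0 < ν →
      ∀ {u : ℝ → UnitAddTorus (Fin 3) → EuclideanSpace ℝ (Fin 3)} {p : ℝ → UnitAddTorus (Fin 3) → ℝ},
      Torus.IsClassicalNSSolutionOn (Icc a b) ν 0 u p →
      (∀ t ∈ Icc a b, ∀ i j : Fin 3,
        ∫ x, |Torus.partialDeriv i (Torus.partialDeriv j (p t)) x| ^ q ≤
          CP * ∫ x, (∑ k, ‖Torus.partialDeriv k (u t) x‖ ^ 2) ^ q) →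
      ∀ {g : EuclideanSpace ℝ (Fin 3 × Fin 3) → ℝ}, ConvexOn ℝ univ g → LipschitzWith 1 g →
      (∀ v : UnitAddTorus (Fin 3) → EuclideanSpace ℝ (Fin 3), Torus.IsSmooth v →
        Torus.IsDivFree v → ∀ x, 0 ≤ g (strainFlat v x)) →
      (∀ v : UnitAddTorus (Fin 3) → EuclideanSpace ℝ (Fin 3), Torus.IsSmooth v →
        Torus.IsDivFree v → ∀ x, ‖strainFlat v x‖ ≤ 6 * g (strainFlat v x)) →
      ∀ (φ : ContDiffBump (0 : EuclideanSpace ℝ (Fin 3 × Fin 3))) {τ : ℝ}, τ ∈ Icc a b →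
      ∃ D : ℝ, HasDerivWithinAt (fun s => ∫ y, weight φ g q (strainFlat (u s) y)) D (Icc a b) τ ∧
        D ≤ ν * (1 - β) *
              (∫ y, fderiv ℝ (weight φ g q) (strainFlat (u τ) y)
                (Torus.laplacian (strainFlat (u τ)) y)) +
            2 * β * ν * (∫ y, weight φ g q (strainFlat (u τ) y)) +
            Kc * ν ^ (-((3 * q - 3) / (2 * q - 3))) *
              ((∫ y, lamReg φ g (strainFlat (u τ) y) ^ (2 : ℝ)) *
                (∫ y, weight φ g q (strainFlat (u τ) y)) ^ (1 + (2 * q - 3)⁻¹)) := by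
  have hq0 : 0 < q := by linarith
  set C : ℝ := Real.sqrt 2 * (1 * K * (6 : ℝ) ^ (2 * q)) ^ (1 / q) * CS ^ ((3 * q - 3) / (5 * q - 6) / 3) +
      Real.sqrt 2 * ((9 : ℝ) ^ q * CP * K * (6 : ℝ) ^ (2 * q)) ^ (1 / q) *
        CS ^ ((3 * q - 3) / (5 * q - 6) / 3) with hC
  have hC0 : 0 ≤ C := by rw [hC]; positivity
  refine ⟨q * C ^ (1 / (1 - (3 * q - 3) / (5 * q - 6))) * (2 * β / q) ^ (-((3 * q - 3) / (2 * q - 3))),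
    by positivity, ?_⟩
  intro a b ν hab hν u p hsol hCP g hconv hlip hg0 hg6 φ τ hτ
  obtain ⟨D, hD, hle⟩ := weight_hasDerivWithinAt_TLD hq hCS hK0 hCP0 hSob hK hab hν hsol hCP hconv
    hlip hg0 hg6 φ hτ hβ0
  refine ⟨D, hD, ?_⟩
  have hsplit : (2 * β * ν / q) ^ (-((3 * q - 3) / (2 * q - 3))) =
      (2 * β / q) ^ (-((3 * q - 3) / (2 * q - 3))) * ν ^ (-((3 * q - 3) / (2 * q - 3))) := by
    rw [← Real.mul_rpow (by positivity) hν.le]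
    congr 1
    field_simp
  rw [hsplit] at hle
  calc D ≤ _ := hle
    _ = _ := by rw [hC]; ring

end TopEig

end Summit.NavierStokesRegularity.FunctionalMining

end
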